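import Literature.AlgebraicGeometry.Motives.HodgeStructureExteriorPowerComplexInvariants
import Literature.AlgebraicGeometry.Motives.MumfordTateInvariantsScalarExtension
import HarnessLib

/-!
# Deligne's `G(K)`-eigentensors and the `Hg(H)(K)`-invariants of `T^{a,b}_K` are spanned by Hodge classes

Deligne, *Hodge cycles on abelian varieties* (LNM 900), I §3: the Mumford–Tate group `G ⊂ GL(V) × 𝔾_m` is
"the set of `g ∈ GL(V)` for which there exists a `ν(g)` […] with the property that `gt = ν(g)ᵖ t` for any
`t` […] of type `(p,p)`", and (proof of Prop. 3.4) "for any `t ∈ T`, `t` is of type `(0,0)` if and only if it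
is fixed by `μ(𝔾_m)`"; Green–Griffiths–Kerr, §I.B (I.B.1): "`M_φ` is the subgroup of `G` fixing
`Hg_φ^{•,•}`"; Lange, *Abelian Varieties over the Complex Numbers*, §7.2.2 p. 331: "Tensoring with `ℂ` we
obtain `H^{2p}_{Hodge}(X) ⊗_ℚ ℂ = H^{2p}(X, ℂ)^{Hg(X)(ℂ)}`."

For the `K`-points `MT(H)(K) = H.mumfordTateGroupBaseChange K`, `Hg(H)(K) = H.hodgeGroupBaseChange K` of the
tree (fixing groups of the rational Hodge tensors, on points) acting on `T^{a,b}_K (K ⊗ V)`, `K ⊇ ℚ` a field, and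
`ι = tensorSpaceToBaseChange K V a b` the comparison map, this file proves the "invariant side" of these
statements for NON-RATIONAL tensors — invariants and eigentensors over `K` are `K`-linear combinations of
rational Hodge classes ("invariants commute with extension of scalars", the tree's
`mem_span_image_of_forall_of_isBaseChange`, as in the discharged `Deligne1982_mumfordTateInvariants_baseChange`
(i) `(K ⊗ T)^{MT(K)} = K ⊗ Hdg⁰`):

* §1 (any field `K ⊇ ℚ`, `H` polarised of weight `n` on `V ≠ 0`, `p = nk`, `(a − b) n = 2p`):
  `{s ∈ T^{a,b}_K | ρ(γ) s = ν_Q(γ)ᵏ s ∀ γ ∈ MT(H)(K)} = span_K ι(Hdgᵖ(T^{a,b} H))`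
  (`Polarization.setOf_forall_tensorSpaceActOver_eq_multiplierChar_zpow_smul_eq_span`): Deligne's description
  of `G(K)` by "`gt = ν(g)ᵖ t`", read as a description of the `νᵏ`-eigentensors of `G(K)`. ⇐ is
  `Motives/ExtendedMumfordTateGroup` §7; ⇒ restricts to the rational points `1 ⊗ g`, `g ∈ MT(H)(ℚ)`
  (`ν_K(1 ⊗ g) = ν_ℚ(g)`), descends the joint eigenspace to `ℚ`, and applies the `ℚ`-points converse of
  `Motives/HodgeStructureExteriorPowerComplexInvariants` §2.
* §2 (`K` algebraically closed, `H` polarised of weight one on `V ≠ 0`, `(a − b) = 2p`):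
  `(T^{a,b}_K)^{Hg(H)(K)} = span_K ι(Hdgᵖ(T^{a,b} H))`
  (`Polarization.setOf_forall_hodgeGroupBaseChange_eq_span_of_weight_one`) — (I.B.1) on `K`-points from the
  invariant side, i.e. Lange's "Tensoring with `ℂ`" for every tensor space `T^{a,b}`: for `g ∈ MT(H)(ℚ)`,
  `g_K = c γ₀` with `γ₀ ∈ Hg(H)(K)`, `c² = ν_Q(g)` (`MT(K) = Kˣ · Hg(K)`,
  `Motives/HodgeStructureExteriorPowerComplexInvariants` §1), and `c · id` acts on `T^{a,b}` by `c^{a−b} = ν_Q(g)ᵖ`,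
  so an `Hg(H)(K)`-invariant tensor is a `νᵖ`-eigentensor of the rational points and §1 applies.

NOT here: the Hodge-group statement for weights `≠ ±1` or unpolarised `H` (on points `MT(H)(K)` need not be
`Kˣ · Hg(H)(K)`), or for non-closed `K`.

## References
* [cite: Deligne1982HodgeCycles, I §3 Prop. 3.4 (with proof) and definition of the Mumford–Tate group]
* [cite: GreenGriffithsKerr2012, §I.B (I.B.1) and the semi-direct product remark before it]
* [cite: Lange2023AbelianVarietiesComplex, §7.2.2 p. 331 ("Tensoring with ℂ")]
* [cite: Moonen1999MTNotes, (1.14)]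
-/

noncomputable section

open scoped TensorProduct

universe u v w

namespace Literature.AlgebraicGeometry.Motives

namespace HodgeStructure

variable (K : Type w) [Field K] [Algebra ℚ K] {V : Type u} [AddCommGroup V] [Module ℚ V] [Module.Finite ℚ V]
  [HodgeTensorFacts.{u, u}] {n : ℤ}

/-! ### §1 The `νᵏ`-eigentensors of `MT(H)(K)` on `T^{a,b}_K` are spanned by Hodge classes -/

section Multiplier

variable [Nontrivial V] {H : HodgeStructure V n}

/-- **`MT(H)(K)` acts on `span_K ι(Hdgᵖ(T^{a,b} H))` through `ν_Qᵏ`** (`p = nk`, `(a − b) n = 2p`): Deligne's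
"`gt = ν(g)ᵖ t`" (`Motives/ExtendedMumfordTateGroup` §7) extended `K`-linearly.
[cite: Deligne1982HodgeCycles, I §3 (definition of the Mumford–Tate group)] [cite: Moonen1999MTNotes, (1.14)] -/
theorem Polarization.tensorSpaceActOver_eq_multiplierChar_zpow_smul_of_mem_span (Q : Polarization H) (k : ℤ)
    {a b : ℕ} {p : ℤ} (hpk : p = n * k) (hab : ((a : ℤ) - b) * n = 2 * p)
    {s : hodgeTensorSpaceOver K (K ⊗[ℚ] V) a b}
    (hs : s ∈ Submodule.span K
      (tensorSpaceToBaseChange K V a b '' ((H.tensorSpace a b).hodgeClasses p : Set (hodgeTensorSpace V a b))))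
    {γ : (K ⊗[ℚ] V) ≃ₗ[K] (K ⊗[ℚ] V)} (hγ : γ ∈ H.mumfordTateGroupBaseChange K) :
    tensorSpaceActOver γ s = ((Q.multiplierChar K ⟨γ, hγ⟩ : K) ^ k) • s := by
  induction hs using Submodule.span_induction with
  | mem x hx =>
    obtain ⟨t, ht, rfl⟩ := hx
    exact Q.tensorSpaceActOver_eq_multiplierChar_zpow_smul K hγ k hpk hab ht
  | zero => rw [map_zero, smul_zero]
  | add x y _ _ hx hy => rw [map_add, hx, hy, smul_add]
  | smul c x _ hx => rw [map_smul, hx, smul_comm]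

/-- **Eigentensors of the rational points descend**: if `ρ(1 ⊗ g) s = ν_Q(g)ᵏ s` for every `g ∈ MT(H)(ℚ)`
(`s ∈ T^{a,b}_K (K ⊗ V)`, `p = nk`, `(a − b) n = 2p`), then `s ∈ span_K ι(Hdgᵖ(T^{a,b} H))` — the joint
eigenspace is cut out by rational equations, so "invariants commute with extension of scalars"
(`mem_span_image_of_forall_of_isBaseChange`) puts `s` in the `K`-span of the rational `νᵏ`-eigentensors, which
are Hodge classes of type `(p,p)` (`Motives/HodgeStructureExteriorPowerComplexInvariants` §2, Deligne's
"`gt = ν(g)ᵖ t`" read backwards on `ℚ`-points). [cite: Deligne1982HodgeCycles, I §3 Prop. 3.4 (with proof) and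
definition of the Mumford–Tate group] -/
theorem Polarization.mem_span_image_hodgeClasses_of_forall_glBaseChange (Q : Polarization H) (k : ℤ)
    {a b : ℕ} {p : ℤ} (hpk : p = n * k) (hab : ((a : ℤ) - b) * n = 2 * p)
    {s : hodgeTensorSpaceOver K (K ⊗[ℚ] V) a b}
    (hs : ∀ g : H.mumfordTateGroup, tensorSpaceActOver (glBaseChange K V (g : V ≃ₗ[ℚ] V)) s =
      (algebraMap ℚ K (Q.multiplierCharRat g : ℚ)) ^ k • s) :
    s ∈ Submodule.span K
      (tensorSpaceToBaseChange K V a b '' ((H.tensorSpace a b).hodgeClasses p : Set (hodgeTensorSpace V a b))) := by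
  have key := mem_span_image_of_forall_of_isBaseChange (isBaseChange_tensorSpaceToBaseChange K V a b)
    (ι' := H.mumfordTateGroup)
    (fun g => (tensorSpaceAct (a := a) (b := b) (g : V ≃ₗ[ℚ] V)).toLinearMap)
    (fun g => ((Q.multiplierCharRat g : ℚ) ^ k) • LinearMap.id)
    (fun g => (tensorSpaceActOver (a := a) (b := b) ((g : V ≃ₗ[ℚ] V).baseChange ℚ K V V)).toLinearMap)
    (fun g => (algebraMap ℚ K (Q.multiplierCharRat g : ℚ)) ^ k • LinearMap.id)
    (fun g t => by simp [tensorSpaceToBaseChange_tensorSpaceAct])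
    (fun g t => by
      rw [LinearMap.smul_apply, LinearMap.id_apply, LinearMap.smul_apply, LinearMap.id_apply, map_smul,
        ← map_zpow₀, algebraMap_smul])
    (y := s) (fun g => by simpa using hs g)
  refine Submodule.span_mono (Set.image_mono fun t ht => ?_) key
  exact Q.mem_hodgeClasses_of_forall_tensorSpaceAct_eq_multiplierCharRat_zpow_smul k hpk hab fun g => by
    simpa using ht g

/-- **Deligne's "`gt = ν(g)ᵖ t`" over `K`: the `ν_Qᵏ`-eigentensors of `MT(H)(K)` in `T^{a,b}_K (K ⊗ V)` are exactly
the `K`-span of the rational Hodge classes of type `(p,p)`** (`H` polarised of weight `n`, `V ≠ 0`, `p = nk`,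
`(a − b) n = 2p`, any field `K ⊇ ℚ`). [cite: Deligne1982HodgeCycles, I §3 Prop. 3.4 (with proof) and definition
of the Mumford–Tate group] [cite: Moonen1999MTNotes, (1.14)] -/
theorem Polarization.forall_tensorSpaceActOver_eq_multiplierChar_zpow_smul_iff_mem_span (Q : Polarization H)
    (k : ℤ) {a b : ℕ} {p : ℤ} (hpk : p = n * k) (hab : ((a : ℤ) - b) * n = 2 * p)
    (s : hodgeTensorSpaceOver K (K ⊗[ℚ] V) a b) :
    (∀ (γ : (K ⊗[ℚ] V) ≃ₗ[K] (K ⊗[ℚ] V)) (hγ : γ ∈ H.mumfordTateGroupBaseChange K),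
        tensorSpaceActOver γ s = ((Q.multiplierChar K ⟨γ, hγ⟩ : K) ^ k) • s) ↔
      s ∈ Submodule.span K
        (tensorSpaceToBaseChange K V a b '' ((H.tensorSpace a b).hodgeClasses p : Set (hodgeTensorSpace V a b))) := by
  refine ⟨fun h => Q.mem_span_image_hodgeClasses_of_forall_glBaseChange K k hpk hab fun g => ?_,
    fun hs γ hγ => Q.tensorSpaceActOver_eq_multiplierChar_zpow_smul_of_mem_span K k hpk hab hs hγ⟩
  rw [h (glBaseChange K V (g : V ≃ₗ[ℚ] V)) (mumfordTateGroup_le_comap K H g.2), ← Q.algebraMap_multiplierCharRat K g]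

/-- The same as an equality of subsets of `T^{a,b}_K (K ⊗ V)`.
[cite: Deligne1982HodgeCycles, I §3 Prop. 3.4 (with proof) and definition of the Mumford–Tate group] -/
theorem Polarization.setOf_forall_tensorSpaceActOver_eq_multiplierChar_zpow_smul_eq_span (Q : Polarization H)
    (k : ℤ) {a b : ℕ} {p : ℤ} (hpk : p = n * k) (hab : ((a : ℤ) - b) * n = 2 * p) :
    {s : hodgeTensorSpaceOver K (K ⊗[ℚ] V) a b |
        ∀ (γ : (K ⊗[ℚ] V) ≃ₗ[K] (K ⊗[ℚ] V)) (hγ : γ ∈ H.mumfordTateGroupBaseChange K),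
          tensorSpaceActOver γ s = ((Q.multiplierChar K ⟨γ, hγ⟩ : K) ^ k) • s} =
      (Submodule.span K (tensorSpaceToBaseChange K V a b ''
        ((H.tensorSpace a b).hodgeClasses p : Set (hodgeTensorSpace V a b))) :
          Set (hodgeTensorSpaceOver K (K ⊗[ℚ] V) a b)) :=
  Set.ext fun s => Q.forall_tensorSpaceActOver_eq_multiplierChar_zpow_smul_iff_mem_span K k hpk hab s

end Multiplier

/-! ### §2 Weight one, `K` algebraically closed: `(T^{a,b}_K)^{Hg(H)(K)} = K ⊗ Hdgᵖ(T^{a,b} H)` -/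

section WeightOne

variable [IsAlgClosed K] [Nontrivial V] {H : HodgeStructure V 1}

/-- **The rational points of `MT` act on the `Hg(H)(K)`-invariants of `T^{a,b}_K` through `ν_Qᵖ`** (`H` polarised
of weight one, `V ≠ 0`, `a − b = 2p`, `K` algebraically closed): for `s` fixed by `Hg(H)(K)` and `g ∈ MT(H)(ℚ)`,
`ρ(1 ⊗ g) s = ν_Q(g)ᵖ s` — `1 ⊗ g = c γ₀`, `γ₀ ∈ Hg(H)(K)`, `c² = ν_Q(g)`, and `c · id` acts on `T^{a,b}` by
`cᵃ c⁻ᵇ = (c²)ᵖ`. [cite: GreenGriffithsKerr2012, §I.B (semi-direct product remark before (I.B.1))]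
[cite: Deligne1982HodgeCycles, I §3 Prop. 3.4] -/
theorem Polarization.tensorSpaceActOver_glBaseChange_eq_zpow_smul_of_forall_hodgeGroupBaseChange
    (Q : Polarization H) {a b : ℕ} {p : ℤ} (hab : ((a : ℤ) - b) * 1 = 2 * p)
    {s : hodgeTensorSpaceOver K (K ⊗[ℚ] V) a b}
    (hs : ∀ γ ∈ H.hodgeGroupBaseChange K, tensorSpaceActOver γ s = s) (g : H.mumfordTateGroup) :
    tensorSpaceActOver (glBaseChange K V (g : V ≃ₗ[ℚ] V)) s =
      (algebraMap ℚ K (Q.multiplierCharRat g : ℚ)) ^ p • s := by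
  have hγ : glBaseChange K V (g : V ≃ₗ[ℚ] V) ∈ H.mumfordTateGroupBaseChange K := mumfordTateGroup_le_comap K H g.2
  obtain ⟨c, γ₀, hγ₀, hc, hcγ⟩ := Q.exists_smulOfUnit_mul_of_mem_mumfordTateGroupBaseChange_of_weight_one K hγ
  rw [← Q.algebraMap_multiplierCharRat K g] at hc
  have hc0 : (c : K) ≠ 0 := c.ne_zero
  have hexp : (c : K) ^ a * (((c⁻¹ : Kˣ)) : K) ^ b = (algebraMap ℚ K (Q.multiplierCharRat g : ℚ)) ^ p := by
    rw [← hc, Units.val_inv_eq_inv_val, ← zpow_natCast, ← zpow_natCast, inv_zpow, ← zpow_neg, ← zpow_add₀ hc0,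
      ← zpow_natCast, ← zpow_mul]
    congr 1
    push_cast
    linear_combination hab
  rw [hcγ, tensorSpaceActOver_mul_apply, hs γ₀ hγ₀, tensorSpaceActOver_smulOfUnit, hexp]

/-- **`Hg(H)(K)`-invariant tensors are `K`-combinations of Hodge classes** (`H` polarised of weight one, `V ≠ 0`,
`a − b = 2p`, `K` algebraically closed): `s ∈ (T^{a,b}_K)^{Hg(H)(K)}` lies in `span_K ι(Hdgᵖ(T^{a,b} H))`.
[cite: GreenGriffithsKerr2012, §I.B (I.B.1)] [cite: Lange2023AbelianVarietiesComplex, §7.2.2 p. 331 ("Tensoring with ℂ")] -/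
theorem Polarization.mem_span_image_hodgeClasses_of_forall_hodgeGroupBaseChange (Q : Polarization H)
    {a b : ℕ} {p : ℤ} (hab : ((a : ℤ) - b) * 1 = 2 * p) {s : hodgeTensorSpaceOver K (K ⊗[ℚ] V) a b}
    (hs : ∀ γ ∈ H.hodgeGroupBaseChange K, tensorSpaceActOver γ s = s) :
    s ∈ Submodule.span K
      (tensorSpaceToBaseChange K V a b '' ((H.tensorSpace a b).hodgeClasses p : Set (hodgeTensorSpace V a b))) :=
  Q.mem_span_image_hodgeClasses_of_forall_glBaseChange K p (one_mul p).symm hab fun g =>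
    Q.tensorSpaceActOver_glBaseChange_eq_zpow_smul_of_forall_hodgeGroupBaseChange K hab hs g

/-- **(I.B.1) on `K`-points from the invariant side / "Tensoring with `ℂ`" for `T^{a,b}`**: for `H` polarised of
weight one on `V ≠ 0`, `a − b = 2p` and `K` algebraically closed, a tensor `s ∈ T^{a,b}_K (K ⊗ V)` is fixed by
`Hg(H)(K)` iff `s ∈ span_K ι(Hdgᵖ(T^{a,b} H))` (⇐: `Hg(H)(K) ⊆ Ker ν_Q` acts trivially on `span_K ι(Hdgᵖ)`).
[cite: GreenGriffithsKerr2012, §I.B (I.B.1)] [cite: Lange2023AbelianVarietiesComplex, §7.2.2 p. 331 ("Tensoring with ℂ")]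
[cite: Deligne1982HodgeCycles, I §3 Prop. 3.4 (with proof)] -/
theorem Polarization.forall_hodgeGroupBaseChange_tensorSpaceActOver_eq_iff_mem_span (Q : Polarization H)
    {a b : ℕ} {p : ℤ} (hab : ((a : ℤ) - b) * 1 = 2 * p) (s : hodgeTensorSpaceOver K (K ⊗[ℚ] V) a b) :
    (∀ γ ∈ H.hodgeGroupBaseChange K, tensorSpaceActOver γ s = s) ↔
      s ∈ Submodule.span K
        (tensorSpaceToBaseChange K V a b '' ((H.tensorSpace a b).hodgeClasses p : Set (hodgeTensorSpace V a b))) := by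
  refine ⟨Q.mem_span_image_hodgeClasses_of_forall_hodgeGroupBaseChange K hab, fun hs γ hγ => ?_⟩
  have hγ' : γ ∈ H.mumfordTateGroupBaseChange K := H.hodgeGroupBaseChange_le_mumfordTateGroupBaseChange K hγ
  have h := Q.tensorSpaceActOver_eq_multiplierChar_zpow_smul_of_mem_span K p (one_mul p).symm hab hs hγ'
  have h1 : Q.multiplierChar K ⟨γ, hγ'⟩ = 1 := Q.multiplierChar_eq_one_of_mem_hodgeGroupBaseChange K ⟨γ, hγ'⟩ hγ
  rw [h1, Units.val_one, one_zpow, one_smul] at h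
  exact h

/-- **`(T^{a,b}_K)^{Hg(H)(K)} = K ⊗ Hdgᵖ(T^{a,b} H)`** as an equality of subsets of `T^{a,b}_K (K ⊗ V)` (`H` polarised
of weight one, `V ≠ 0`, `a − b = 2p`, `K` algebraically closed). [cite: GreenGriffithsKerr2012, §I.B (I.B.1)]
[cite: Lange2023AbelianVarietiesComplex, §7.2.2 p. 331 ("Tensoring with ℂ")] -/
theorem Polarization.setOf_forall_hodgeGroupBaseChange_eq_span_of_weight_one (Q : Polarization H) {a b : ℕ}
    {p : ℤ} (hab : ((a : ℤ) - b) * 1 = 2 * p) :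
    {s : hodgeTensorSpaceOver K (K ⊗[ℚ] V) a b | ∀ γ ∈ H.hodgeGroupBaseChange K, tensorSpaceActOver γ s = s} =
      (Submodule.span K (tensorSpaceToBaseChange K V a b ''
        ((H.tensorSpace a b).hodgeClasses p : Set (hodgeTensorSpace V a b))) :
          Set (hodgeTensorSpaceOver K (K ⊗[ℚ] V) a b)) :=
  Set.ext fun s => Q.forall_hodgeGroupBaseChange_tensorSpaceActOver_eq_iff_mem_span K hab s

end WeightOne

end HodgeStructure

end Literature.AlgebraicGeometry.Motives

end
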